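import Literature.NumberTheory.GaloisRepresentations.LubinTateColemanTwoVariableTwistTwo
import Literature.NumberTheory.GaloisRepresentations.LubinTateColemanRelativeGaloisGeneralTwo
import HarnessLib

/-!
# The two-variable Coleman transform under ALL of `Γ_F`: `Col(σ̃·β) = (1 + D_{χ(σ̃)}^{𝒪⟦X⟧})·Col(β^{σ̃|E_∞})`, and for the Frobenius
# `Col(σ₀·β) = (1 + D_{χ(σ₀)}^{𝒪⟦X⟧})((1 + X)·Col(β))` — both Iwasawa variables at once (de Shalit I §3.4, §3.8 (16)–(17), III §1.3)

De Shalit, *Iwasawa theory of elliptic curves with complex multiplication* (1987), Ch. I §3.4 (extension of `i` from `G` to `𝒢`) and §3.8: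
the limit sequence (17) is one of `Λ(𝒢_a)`-modules for the whole Galois group of the two-variable local tower.  In the tree's series currency:
`LubinTateColemanTwoVariableTwistTwo` proved `Col(σ̃·β) = (1 + D_{χ(σ̃)}) Col(β)` for `σ̃` FIXING the unramified tower, and g8's
`series_amice_frob` that the Frobenius `σ₀` acts on transforms of coefficient-twisted families by `·(1 + X)`.  Using the general coordinate
formula `r_{σ̃β} = χ(σ̃)·ρ_{χ(σ̃)}·((r_β)^{σ̃|E} ∘ [χ(σ̃)])` (`relUnitCoordTwo_galAct_eq`, any `σ̃ ∈ Γ_F`) this file joins the two directions: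

* ★★ `isColemanTransform₂_galAct_general` — for ANY `σ̃ ∈ Γ_F`: **if `G` is a transform of the coefficient-twisted family
  `((r_{β_m})^{σ̃|E_m})_m` then `G + D^{𝒪⟦X⟧}_{χ(σ̃)} G` is a transform of `(σ̃·β_m)_m`**;
* ★★★ `isColemanTransform₂_galAct_frob` — **if `G` is a transform of `β` then `(1 + D^{𝒪⟦X⟧}_{χ(σ₀)})((1 + X)·G)` is a transform of `(σ₀·β_m)_m`**
  (`σ₀` an arithmetic Frobenius): the Frobenius acts through BOTH variables, `X = φ − 1` on the unramified coefficients and the Lubin–Tate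
  twist of `χ(σ₀) ∈ 𝒪_F^×`; ★★★ `colemanTransform₂_frob_galAct_eq` — uniqueness form **`Col(σ₀·β) = (1 + D_{χ(σ₀)})((1+X)·Col(β))`**.

Together with `colemanTransform₂_galAct_eq` (elements fixing `E_∞`) this describes the action of a topologically generating set of
`Gal(E_∞·K_π^∞/F)` on `Col(𝒰_∞) ⊆ 𝒪_F⟦X⟧⟦Y⟧ = Λ·1 ⊕ Λ·Y` (`Λ = 𝒪_F⟦X⟧⟦T⟧`, `LubinTateColemanCoordFreeTwoVariable`).  Everything PROVED (0 sorry,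
no named facts, no new definitions).

## References

* E. de Shalit, *Iwasawa theory of elliptic curves with complex multiplication* (1987), Ch. I §3.4, §3.8 (16)–(17); Ch. III §1.3. [deShalit1987]
-/

noncomputable section

open scoped PowerSeries.WithPiTopology

namespace Literature.NumberTheory.GaloisRepresentations

section TwoVariableTwistFrobTwo

open GaloisRepresentations.IsNonarchimedeanLocalField LubinTate ValuativeRel Field Finset

variable {F : Type} [Field F] [ValuativeRel F] [TopologicalSpace F] [IsNonarchimedeanLocalField F]

attribute [local instance] ltNormUniformSpace ltNormIsUniformAddGroup rk1 nF nE fintypeResidueField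

variable {π : 𝒪[F]} (hπ : (valuation F).IsUniformizer (π : F)) (hq : residueFieldCard F = 2)
variable (p : ℕ) [hp : Fact p.Prime]
variable (E : ℕ → IntermediateField F (AlgebraicClosure F)) [∀ m, FiniteDimensional F (E m)] [∀ m, Normal F (E m)]
  [∀ m, IsGalois F (E m)] (hmono : Monotone E) (hE : ∀ m, E m ≤ maxUnramified F) (hdeg : ∀ m, Module.finrank F (E m) = p ^ m)
  {σ₀ : absoluteGaloisGroup F} (hσ₀ : IsAbsArithFrob σ₀)

/-- ★★ **Any `σ̃ ∈ Γ_F`: if `G` is a transform of the coefficient-twisted family `((r_{β_m})^{σ̃|E_m})_m`, then `G + D^{𝒪⟦X⟧}_{χ(σ̃)} G` is a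
transform of `(σ̃·β_m)_m`** (levelwise `r_{σ̃β_m} = (1 + D^{𝒪_{E_m}}_{χ(σ̃)})((r_{β_m})^{σ̃|E_m})` by `relUnitCoordTwo_galAct_eq`, and the congruences
pass through the twist by `dvd_coeff_twistLinearBase_sub_sum`). [cite: deShalit1987, Ch. I §3.4, §3.8 (16)–(17)] -/
theorem isColemanTransform₂_galAct_general {θ : ∀ m, unitBall (E m)} (hθ : ∀ m, IsIntegralNormalGen (E m) (θ m)) (u : (LTCoeff F)ˣ)
    (hu : LTCoeff.of F π = residueFieldCard F * u) (β : ∀ m, RelNormCoherentUnits hπ (E m)) (σ : absoluteGaloisGroup F)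
    {G : PowerSeries (PowerSeries 𝒪[F])}
    (hG : ∀ m k, ((1 + PowerSeries.X : PowerSeries 𝒪[F]) ^ p ^ m - 1) ∣
      PowerSeries.coeff k G - ∑ i : ZMod (p ^ m), PowerSeries.C ((hθ m).basis.repr
        (PowerSeries.coeff k (PowerSeries.map (frobUnitBall (E m) σ : unitBall (E m) →+* unitBall (E m))
          (relUnitCoordTwo hπ (E m) hq (hE m) hσ₀ u hu (β m))))
        (((absoluteGaloisGroup.toAlgEquiv F σ₀).restrictNormal (E m)) ^ i.val)) * (1 + PowerSeries.X) ^ i.val) (m k : ℕ) :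
    ((1 + PowerSeries.X : PowerSeries 𝒪[F]) ^ p ^ m - 1) ∣
      PowerSeries.coeff k (G + twistLinearBase hπ hq ((PowerSeries.C (R := 𝒪[F])).comp (LTCoeff.of F).symm.toRingHom) u
        (lubinTateChar hπ σ) G) - ∑ i : ZMod (p ^ m), PowerSeries.C ((hθ m).basis.repr
        (PowerSeries.coeff k (relUnitCoordTwo hπ (E m) hq (hE m) hσ₀ u hu ((β m).galAct σ)))
        (((absoluteGaloisGroup.toAlgEquiv F σ₀).restrictNormal (E m)) ^ i.val)) * (1 + PowerSeries.X) ^ i.val := by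
  set x := PowerSeries.map (frobUnitBall (E m) σ : unitBall (E m) →+* unitBall (E m)) (relUnitCoordTwo hπ (E m) hq (hE m) hσ₀ u hu (β m))
    with hx
  -- levelwise: `r_{σ̃β_m} = x + D^{𝒪_{E_m}} x`
  have hlev : relUnitCoordTwo hπ (E m) hq (hE m) hσ₀ u hu ((β m).galAct σ) =
      x + twistLinearBase hπ hq (algebraMap (LTCoeff F) (unitBall (E m))) u (lubinTateChar hπ σ) x := by
    rw [relUnitCoordTwo_galAct_eq hπ (E m) hq (hE m) hσ₀ u hu (β m) σ, twistLinearBase_apply, add_sub_cancel, hx]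
    rfl
  rw [hlev, map_add, map_add]
  have e : ∀ (a b c d : PowerSeries 𝒪[F]), a + b - (c + d) = (a - c) + (b - d) := fun a b c d => by ring
  have hsum : ∑ i : ZMod (p ^ m), PowerSeries.C ((hθ m).basis.repr (PowerSeries.coeff k x + PowerSeries.coeff k
          (twistLinearBase hπ hq (algebraMap (LTCoeff F) (unitBall (E m))) u (lubinTateChar hπ σ) x))
        (((absoluteGaloisGroup.toAlgEquiv F σ₀).restrictNormal (E m)) ^ i.val)) * (1 + PowerSeries.X) ^ i.val =
      ∑ i : ZMod (p ^ m), PowerSeries.C ((hθ m).basis.repr (PowerSeries.coeff k x)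
        (((absoluteGaloisGroup.toAlgEquiv F σ₀).restrictNormal (E m)) ^ i.val)) * (1 + PowerSeries.X) ^ i.val +
      ∑ i : ZMod (p ^ m), PowerSeries.C ((hθ m).basis.repr (PowerSeries.coeff k
          (twistLinearBase hπ hq (algebraMap (LTCoeff F) (unitBall (E m))) u (lubinTateChar hπ σ) x))
        (((absoluteGaloisGroup.toAlgEquiv F σ₀).restrictNormal (E m)) ^ i.val)) * (1 + PowerSeries.X) ^ i.val := by
    rw [← sum_add_distrib]
    refine sum_congr rfl fun i _ => ?_
    rw [map_add, Finsupp.add_apply, map_add, add_mul]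
  rw [hsum, e]
  exact dvd_add (hG m k) (dvd_coeff_twistLinearBase_sub_sum hπ hq (hθ m) Finset.univ _ _ _ u (lubinTateChar hπ σ) (fun k' => hG m k') k)

include hdeg in
/-- ★★★ **The Frobenius acts through both variables**: if `G` is a transform of `β`, then `(1 + D^{𝒪⟦X⟧}_{χ(σ₀)})((1 + X)·G)` is a transform of
`(σ₀·β_m)_m` (`σ₀` an arithmetic Frobenius: `(1+X)·G` is a transform of the coefficient-twisted family by `series_amice_frob`, then
`isColemanTransform₂_galAct_general`). [cite: deShalit1987, Ch. I §3.4, §3.8 (16)–(17); Ch. III §1.3] -/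
theorem isColemanTransform₂_galAct_frob {θ : ∀ m, unitBall (E m)} (hθ : ∀ m, IsIntegralNormalGen (E m) (θ m)) (u : (LTCoeff F)ˣ)
    (hu : LTCoeff.of F π = residueFieldCard F * u) (β : ∀ m, RelNormCoherentUnits hπ (E m)) {G : PowerSeries (PowerSeries 𝒪[F])}
    (hG : ∀ m k, ((1 + PowerSeries.X : PowerSeries 𝒪[F]) ^ p ^ m - 1) ∣
      PowerSeries.coeff k G - ∑ i : ZMod (p ^ m), PowerSeries.C ((hθ m).basis.repr
        (PowerSeries.coeff k (relUnitCoordTwo hπ (E m) hq (hE m) hσ₀ u hu (β m)))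
        (((absoluteGaloisGroup.toAlgEquiv F σ₀).restrictNormal (E m)) ^ i.val)) * (1 + PowerSeries.X) ^ i.val) (m k : ℕ) :
    ((1 + PowerSeries.X : PowerSeries 𝒪[F]) ^ p ^ m - 1) ∣
      PowerSeries.coeff k (PowerSeries.C (1 + PowerSeries.X : PowerSeries 𝒪[F]) * G +
        twistLinearBase hπ hq ((PowerSeries.C (R := 𝒪[F])).comp (LTCoeff.of F).symm.toRingHom) u (lubinTateChar hπ σ₀)
          (PowerSeries.C (1 + PowerSeries.X : PowerSeries 𝒪[F]) * G)) - ∑ i : ZMod (p ^ m), PowerSeries.C ((hθ m).basis.repr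
        (PowerSeries.coeff k (relUnitCoordTwo hπ (E m) hq (hE m) hσ₀ u hu ((β m).galAct σ₀)))
        (((absoluteGaloisGroup.toAlgEquiv F σ₀).restrictNormal (E m)) ^ i.val)) * (1 + PowerSeries.X) ^ i.val :=
  isColemanTransform₂_galAct_general hπ hq p E hE hσ₀ hθ u hu β σ₀
    (fun m' k' => series_amice_frob p E hE hdeg hσ₀ hθ (fun n => relUnitCoordTwo hπ (E n) hq (hE n) hσ₀ u hu (β n)) G hG m' k') m k

include hdeg in
/-- ★★★ **`Col(σ₀·β) = (1 + D_{χ(σ₀)}^{𝒪⟦X⟧})((1 + X)·Col(β))`**: for a baseNorm-coherent family `β` and an arithmetic Frobenius `σ₀`, the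
transform `G'` of `(σ₀·β_m)_m` is obtained from the transform `G` of `β` by multiplying by `1 + X` (unramified variable) and applying the
Lubin–Tate twist of `χ(σ₀)` — with `colemanTransform₂_galAct_eq` (elements fixing `E_∞`, pure Lubin–Tate twist) this gives the action of a
generating set of `Gal(E_∞·K_π^∞/F)` on the image of the two-variable Coleman transform in `𝒪_F⟦X⟧⟦Y⟧`. [cite: deShalit1987, Ch. I §3.4, §3.8 (16)–(17); Ch. III §1.3] -/
theorem colemanTransform₂_frob_galAct_eq [IsAdicComplete (Ideal.span {(p : 𝒪[F])}) 𝒪[F]] {θ : ∀ m, unitBall (E m)}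
    (hθ : ∀ m, IsIntegralNormalGen (E m) (θ m)) (hcoh : ∀ m, unitBallTrace (hmono (Nat.le_succ m)) (θ (m + 1)) = θ m)
    (u : (LTCoeff F)ˣ) (hu : LTCoeff.of F π = residueFieldCard F * u) {β : ∀ m, RelNormCoherentUnits hπ (E m)}
    (hβ : ∀ m, (β (m + 1)).baseNorm hπ (hmono (Nat.le_succ m)) = β m) {G G' : PowerSeries (PowerSeries 𝒪[F])}
    (hG : ∀ m k, ((1 + PowerSeries.X : PowerSeries 𝒪[F]) ^ p ^ m - 1) ∣
      PowerSeries.coeff k G - ∑ i : ZMod (p ^ m), PowerSeries.C ((hθ m).basis.repr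
        (PowerSeries.coeff k (relUnitCoordTwo hπ (E m) hq (hE m) hσ₀ u hu (β m)))
        (((absoluteGaloisGroup.toAlgEquiv F σ₀).restrictNormal (E m)) ^ i.val)) * (1 + PowerSeries.X) ^ i.val)
    (hG' : ∀ m k, ((1 + PowerSeries.X : PowerSeries 𝒪[F]) ^ p ^ m - 1) ∣
      PowerSeries.coeff k G' - ∑ i : ZMod (p ^ m), PowerSeries.C ((hθ m).basis.repr
        (PowerSeries.coeff k (relUnitCoordTwo hπ (E m) hq (hE m) hσ₀ u hu ((β m).galAct σ₀)))
        (((absoluteGaloisGroup.toAlgEquiv F σ₀).restrictNormal (E m)) ^ i.val)) * (1 + PowerSeries.X) ^ i.val) :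
    G' = PowerSeries.C (1 + PowerSeries.X : PowerSeries 𝒪[F]) * G +
      twistLinearBase hπ hq ((PowerSeries.C (R := 𝒪[F])).comp (LTCoeff.of F).symm.toRingHom) u (lubinTateChar hπ σ₀)
        (PowerSeries.C (1 + PowerSeries.X : PowerSeries 𝒪[F]) * G) :=
  (existsUnique_colemanTransform₂ p hπ E hmono hE hdeg hσ₀ hq hθ hcoh u hu (galAct_baseNormCoherent hπ E hmono σ₀ hβ)).unique hG'
    (isColemanTransform₂_galAct_frob hπ hq p E hE hdeg hσ₀ hθ u hu β hG)

end TwoVariableTwistFrobTwo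

end Literature.NumberTheory.GaloisRepresentations
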